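import Summits.AnomalousDissipation.AnomalousDissipation.Theses.TaylorCertificates
import Literature.Analysis.FluidPDE.StatisticalSolutionEnergyEq
import Literature.Analysis.FluidPDE.StatisticalSolutionProofs
import Literature.Analysis.FunctionSpaces.TorusSobolevSpaceProofs
import Literature.Analysis.FunctionSpaces.TorusFourierCalculus
import Literature.Analysis.FunctionSpaces.TorusTrigPoly

/-!
# `TaylorCertificates.FloorCertificateEnsembleCeiling` (stmt-AnomalousDissipation-14086) — negative side IV:
# no lean statistics (the Liouville equation tested with the force), and the vacuity of the ceiling half alone

Crux `X = FloorCertificateEnsembleCeiling` (FLOOR certificate + ν-uniform ensemble CEILING for ONE force; see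
`Negative/SteadyPinch.lean`). This file (cdisprove seat `refuter-cdisprove-stmt-AnomalousDissipation-14086-g2-0`,
2026-08-16; crux work file `Cruxes/FloorCertificateEnsembleCeiling/Disproof.lean` §D.2/§G re-based on the route file
and the Literature layer only, without auxiliary definitions) proves, for EVERY force:

* `exists_cylindricalTest_grad_eq_on_ball` — for `w ∈ 𝒱` and `ρ ≥ 0` a cylindrical test functional `Φ` (one
  coordinate `(·, w)`, profile `y ↦ y₀ χ(y)` with `χ` a smooth bump) whose differential is `w` on the `H`-ball
  `|u| ≤ ρ` — the constructor that turns the Liouville equation (FMRT IV (1.30)) into LINEAR identities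
  `∫ ⟨F(u), w⟩ dμ = 0` on the support ball (1.34);
* `force_sq_le_of_isStationary` — testing (1.30) with `w = f`: `‖f‖₂² ≤ ν ‖Δf‖₂ √e(μ) + K e(μ)` (`K = sup ‖∇f‖`) for
  every stationary statistical solution of `NS_ν(f)` (Doering–Foias 2002 `Re ≳ Gr^{1/2}`, ENSEMBLE form);
  `ensembleEnergy_lower_bound` — NO LEAN STATISTICS: `e(μ) ≥ min(1, (‖f‖₂²/(ν‖Δf‖₂ + K))²)`, a ν-uniform (`ν ≤ 1`)
  positive lower bound on the energy of EVERY invariant statistics of a nonzero force: the quiet side of X's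
  adversary can never be realised near rest, and X's ceiling has `E ≥ ‖f‖₂²/‖∇f‖_∞ − O(ν)`;
* `ensembleEnergy_eq_zero_of_zero_force`, `floorCertificateEnsembleCeiling_without_floor_trivial` — LOAD-BEARING
  FLOOR: the CEILING half of `X` alone (with the admissibility clauses of `X`, which do not exclude `f = 0`) is TRUE
  for the wrong reason — every stationary statistics of unforced Navier–Stokes is `δ_0`. It is the floor (through
  `Negative/SteadyPinch.force_pos_of_pair`) that excludes the trivial force.
-/

noncomputable section

set_option linter.dupNamespace false

open MeasureTheory UnitAddTorus Filter Topology
open scoped InnerProductSpace ENNReal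

namespace Summit.AnomalousDissipation.AnomalousDissipation.Theorems.FloorCertificateEnsembleCeiling.Negative

open Literature.Analysis.FunctionSpaces Literature.Analysis.FluidPDE
open Summit.AnomalousDissipation.AnomalousDissipation.Theses.TaylorCertificates

/-! ## A cylindrical functional whose differential is a given test field on a ball -/

/-- **A cylindrical functional whose differential is a GIVEN test field on an `H`-ball.** For `w ∈ 𝒱` and `ρ ≥ 0`
there is a cylindrical `Φ` (one coordinate `(·, w)`, profile `y ↦ y₀ χ(y)` with `χ` a smooth bump `≡ 1` on the
closed `R`-ball, `R = ρ‖w‖₂ + 1`) with `Φ'(u) = w` whenever `|u| ≤ ρ`. -/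
theorem exists_cylindricalTest_grad_eq_on_ball {w : (UnitAddTorus (Fin 3) → EuclideanSpace ℝ (Fin 3))} (hw : Torus.IsSmooth w) (hdw : Torus.IsDivFree w)
    (hzw : Torus.HasZeroMean w) {ρ : ℝ} (hρ : 0 ≤ ρ) :
    ∃ Φ : Torus.CylindricalTest (Fin 3), ∀ u : Torus.energySpace (Fin 3), ‖u‖ ≤ ρ → Φ.grad u = w := by
  have hw2 : MemLp w 2 volume := hw.memLp 2
  set R : ℝ := ρ * ‖hw2.toLp w‖ + 1 with hRdef
  have hR : 0 < R := by positivity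
  let χ : ContDiffBump (0 : EuclideanSpace ℝ (Fin 1)) := ⟨R, R + 1, hR, by linarith⟩
  set a : EuclideanSpace ℝ (Fin 1) → ℝ := fun y => EuclideanSpace.proj (𝕜 := ℝ) (0 : Fin 1) y with ha
  have ha_diff : ContDiff ℝ 1 a := (EuclideanSpace.proj (𝕜 := ℝ) (0 : Fin 1)).contDiff
  have hχ_diff : ContDiff ℝ 1 (χ : EuclideanSpace ℝ (Fin 1) → ℝ) := χ.contDiff
  let Φ : Torus.CylindricalTest (Fin 3) :=
    { m := 1
      g := fun _ => w
      g_smooth := fun _ => hw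
      g_divFree := fun _ => hdw
      g_zeroMean := fun _ => hzw
      φ := fun y => a y * χ y
      φ_contDiff := ha_diff.mul hχ_diff
      φ_compact := χ.hasCompactSupport.mul_left }
  refine ⟨Φ, fun u hu => ?_⟩
  have hpair : |Torus.pairing (u : Lp (EuclideanSpace ℝ (Fin 3)) 2 (volume : Measure (UnitAddTorus (Fin 3)))) w| < R := by
    calc |Torus.pairing (u : Lp (EuclideanSpace ℝ (Fin 3)) 2 (volume : Measure (UnitAddTorus (Fin 3)))) w| ≤ ‖u‖ * ‖hw2.toLp w‖ := Torus.abs_pairing_coe_le hw2 u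
      _ ≤ ρ * ‖hw2.toLp w‖ := mul_le_mul_of_nonneg_right hu (norm_nonneg _)
      _ < R := by rw [hRdef]; linarith
  set y₀ : EuclideanSpace ℝ (Fin 1) := Φ.coords u with hy₀
  have hy₀c : y₀ = WithLp.toLp 2 (fun _ : Fin 1 => Torus.pairing (u : Lp (EuclideanSpace ℝ (Fin 3)) 2 (volume : Measure (UnitAddTorus (Fin 3)))) w) := rfl
  have hball : y₀ ∈ Metric.ball (0 : EuclideanSpace ℝ (Fin 1)) χ.rIn := by
    rw [Metric.mem_ball, dist_zero_right, hy₀c, EuclideanSpace.norm_eq]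
    simp only [Fin.sum_univ_one, Real.norm_eq_abs, sq_abs]
    rw [Real.sqrt_sq_eq_abs]
    exact hpair
  have hχ1 : (χ : EuclideanSpace ℝ (Fin 1) → ℝ) y₀ = 1 :=
    χ.one_of_mem_closedBall (Metric.ball_subset_closedBall hball)
  have hχ' : _root_.fderiv ℝ (χ : EuclideanSpace ℝ (Fin 1) → ℝ) y₀ = 0 := by
    rw [(χ.eventuallyEq_one_of_mem_ball hball).fderiv_eq]
    exact fderiv_const_apply (1 : ℝ)
  have hderiv : _root_.fderiv ℝ Φ.φ (Φ.coords u) (EuclideanSpace.single (0 : Fin 1) (1 : ℝ)) = 1 := by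
    rw [← hy₀]
    change _root_.fderiv ℝ (fun y => a y * χ y) y₀ (EuclideanSpace.single (0 : Fin 1) (1 : ℝ)) = 1
    have hfun : (fun y => a y * (χ : EuclideanSpace ℝ (Fin 1) → ℝ) y) = a * (χ : EuclideanSpace ℝ (Fin 1) → ℝ) := rfl
    rw [hfun, fderiv_mul (ha_diff.differentiable one_ne_zero y₀) (hχ_diff.differentiable one_ne_zero y₀), hχ1, hχ',
      smul_zero, zero_add, one_smul]
    rw [ha, ContinuousLinearMap.fderiv]
    simp
  funext x
  change ∑ i : Fin 1, (_root_.fderiv ℝ Φ.φ (Φ.coords u) (EuclideanSpace.single i 1)) • Φ.g i x = w x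
  rw [Fin.sum_univ_one, hderiv, one_smul]

/-! ## The Liouville equation tested with the force: no lean statistics -/

/-- The generator paired with the force itself: `⟨F(u), f⟩ = ‖f‖₂² + ν (u, Δf) + ∫ (u ⊗ u) : ∇f`. -/
theorem nsGeneratorPairing_force (ν : ℝ) (f : (UnitAddTorus (Fin 3) → EuclideanSpace ℝ (Fin 3))) (u : Torus.energySpace (Fin 3)) :
    Torus.nsGeneratorPairing ν f u f =
      (∫ x, ‖f x‖ ^ 2) + ν * Torus.pairing (u : Lp (EuclideanSpace ℝ (Fin 3)) 2 (volume : Measure (UnitAddTorus (Fin 3)))) (Torus.laplacian f) + Torus.inertialPairing (u : Lp (EuclideanSpace ℝ (Fin 3)) 2 (volume : Measure (UnitAddTorus (Fin 3)))) f := by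
  unfold Torus.nsGeneratorPairing
  have h1 : (∫ x, ⟪f x, f x⟫_ℝ) = ∫ x, ‖f x‖ ^ 2 :=
    integral_congr_ae (ae_of_all _ fun x => real_inner_self_eq_norm_sq _)
  rw [h1]
  rfl

/-- The inertial pairing against a field with `‖Dw‖ ≤ K` is bounded by `K |u|²` (pointwise Cauchy–Schwarz). -/
theorem abs_inertialPairing_le_of_fderiv_le {w : (UnitAddTorus (Fin 3) → EuclideanSpace ℝ (Fin 3))} {K : ℝ} (hK : ∀ x, ‖Torus.fderiv w x‖ ≤ K) (u : Torus.energySpace (Fin 3)) :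
    |Torus.inertialPairing (u : Lp (EuclideanSpace ℝ (Fin 3)) 2 (volume : Measure (UnitAddTorus (Fin 3)))) w| ≤ K * ‖u‖ ^ 2 := by
  have hmem : MemLp ((u : Lp (EuclideanSpace ℝ (Fin 3)) 2 (volume : Measure (UnitAddTorus (Fin 3)))) : UnitAddTorus (Fin 3) → EuclideanSpace ℝ (Fin 3)) 2 volume := Lp.memLp _
  have hint : Integrable (fun x => ‖((u : Lp (EuclideanSpace ℝ (Fin 3)) 2 (volume : Measure (UnitAddTorus (Fin 3)))) : UnitAddTorus (Fin 3) → EuclideanSpace ℝ (Fin 3)) x‖ ^ 2) volume :=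
    (memLp_two_iff_integrable_sq_norm hmem.1).1 hmem
  have h : |Torus.inertialPairing (u : Lp (EuclideanSpace ℝ (Fin 3)) 2 (volume : Measure (UnitAddTorus (Fin 3)))) w| ≤ K * ‖(u : Lp (EuclideanSpace ℝ (Fin 3)) 2 (volume : Measure (UnitAddTorus (Fin 3))))‖ ^ 2 := by
    unfold Torus.inertialPairing
    rw [← Torus.integral_norm_sq_coe_eq (u : Lp (EuclideanSpace ℝ (Fin 3)) 2 (volume : Measure (UnitAddTorus (Fin 3)))), ← integral_const_mul, ← Real.norm_eq_abs]
    refine norm_integral_le_of_norm_le (hint.const_mul K) (ae_of_all _ fun x => ?_)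
    rw [Real.norm_eq_abs]
    calc |⟪Torus.fderiv w x (((u : Lp (EuclideanSpace ℝ (Fin 3)) 2 (volume : Measure (UnitAddTorus (Fin 3)))) : UnitAddTorus (Fin 3) → EuclideanSpace ℝ (Fin 3)) x), ((u : Lp (EuclideanSpace ℝ (Fin 3)) 2 (volume : Measure (UnitAddTorus (Fin 3)))) : UnitAddTorus (Fin 3) → EuclideanSpace ℝ (Fin 3)) x⟫_ℝ|
          ≤ ‖Torus.fderiv w x (((u : Lp (EuclideanSpace ℝ (Fin 3)) 2 (volume : Measure (UnitAddTorus (Fin 3)))) : UnitAddTorus (Fin 3) → EuclideanSpace ℝ (Fin 3)) x)‖ * ‖((u : Lp (EuclideanSpace ℝ (Fin 3)) 2 (volume : Measure (UnitAddTorus (Fin 3)))) : UnitAddTorus (Fin 3) → EuclideanSpace ℝ (Fin 3)) x‖ := abs_real_inner_le_norm _ _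
      _ ≤ (‖Torus.fderiv w x‖ * ‖((u : Lp (EuclideanSpace ℝ (Fin 3)) 2 (volume : Measure (UnitAddTorus (Fin 3)))) : UnitAddTorus (Fin 3) → EuclideanSpace ℝ (Fin 3)) x‖) * ‖((u : Lp (EuclideanSpace ℝ (Fin 3)) 2 (volume : Measure (UnitAddTorus (Fin 3)))) : UnitAddTorus (Fin 3) → EuclideanSpace ℝ (Fin 3)) x‖ :=
          mul_le_mul_of_nonneg_right (ContinuousLinearMap.le_opNorm _ _) (norm_nonneg _)
      _ ≤ (K * ‖((u : Lp (EuclideanSpace ℝ (Fin 3)) 2 (volume : Measure (UnitAddTorus (Fin 3)))) : UnitAddTorus (Fin 3) → EuclideanSpace ℝ (Fin 3)) x‖) * ‖((u : Lp (EuclideanSpace ℝ (Fin 3)) 2 (volume : Measure (UnitAddTorus (Fin 3)))) : UnitAddTorus (Fin 3) → EuclideanSpace ℝ (Fin 3)) x‖ :=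
          mul_le_mul_of_nonneg_right (mul_le_mul_of_nonneg_right (hK x) (norm_nonneg _)) (norm_nonneg _)
      _ = K * ‖((u : Lp (EuclideanSpace ℝ (Fin 3)) 2 (volume : Measure (UnitAddTorus (Fin 3)))) : UnitAddTorus (Fin 3) → EuclideanSpace ℝ (Fin 3)) x‖ ^ 2 := by ring
  exact h

/-- **The inertial lower bound on the energy of EVERY stationary statistics (Doering–Foias 2002, ensemble form;
FMRT IV (1.30) tested with `Φ' = f`).** For `ν > 0`, a smooth solenoidal mean-zero `f` with `‖∇f‖ ≤ K`, and any
stationary statistical solution `μ` of `NS_ν(f)`: `‖f‖₂² ≤ ν ‖Δf‖₂ √e(μ) + K e(μ)`. Proof: the Liouville equation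
for the cylindrical functional of `exists_cylindricalTest_grad_eq_on_ball` on the support ball `|u| ≤ ‖f‖₂/(4π²ν)`
(1.34) reads `∫ ⟨F(u), f⟩ dμ = 0`, i.e. `‖f‖₂² = −ν ∫(u,Δf)dμ − ∫∫(u⊗u):∇f dμ`; Cauchy–Schwarz twice. -/
theorem force_sq_le_of_isStationary {ν : ℝ} (hν : 0 < ν) {f : (UnitAddTorus (Fin 3) → EuclideanSpace ℝ (Fin 3))} (hfs : Torus.IsSmooth f)
    (hfd : Torus.IsDivFree f) (hfz : Torus.HasZeroMean f) {K : ℝ} (hK : ∀ x, ‖Torus.fderiv f x‖ ≤ K)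
    {μ : Measure (Torus.energySpace (Fin 3))} (hμ : Torus.IsStationaryStatisticalSolution ν f μ) :
    ∫ x, ‖f x‖ ^ 2 ≤ ν * (‖(hfs.laplacian.memLp 2).toLp (Torus.laplacian f)‖ * Real.sqrt (Torus.ensembleEnergy μ)) +
      K * Torus.ensembleEnergy μ := by
  haveI := hμ.prob
  have hf2 : MemLp f 2 volume := hfs.memLp 2
  have hΔ2 : MemLp (Torus.laplacian f) 2 volume := hfs.laplacian.memLp 2
  set F : ℝ := ‖hf2.toLp f‖ with hF
  set L : ℝ := ‖hΔ2.toLp (Torus.laplacian f)‖ with hL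
  have hF0 : 0 ≤ F := norm_nonneg _
  have hL0 : 0 ≤ L := norm_nonneg _
  have hK0 : 0 ≤ K := (norm_nonneg _).trans (hK 0)
  -- the localising cylindrical functional on the support ball
  set ρ : ℝ := F / (4 * Real.pi ^ 2 * ν) with hρ
  have hρ0 : 0 ≤ ρ := by positivity
  obtain ⟨Φ, hΦ⟩ := exists_cylindricalTest_grad_eq_on_ball hfs hfd hfz hρ0
  have hgrad : ∀ᵐ u ∂μ, Φ.grad u = f := by
    filter_upwards [hμ.ae_norm_le hν hf2] with u hu
    exact hΦ u hu
  -- the Liouville equation with `Φ' = f` a.e.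
  obtain ⟨hGint, hG0⟩ := hμ.generator Φ
  set N : Torus.energySpace (Fin 3) → ℝ := fun u => (∫ x, ‖f x‖ ^ 2) + ν * Torus.pairing (u : Lp (EuclideanSpace ℝ (Fin 3)) 2 (volume : Measure (UnitAddTorus (Fin 3)))) (Torus.laplacian f) +
    Torus.inertialPairing (u : Lp (EuclideanSpace ℝ (Fin 3)) 2 (volume : Measure (UnitAddTorus (Fin 3)))) f with hN
  have hae : (fun u => Torus.nsGeneratorPairing ν f u (Φ.grad u)) =ᵐ[μ] N := by
    filter_upwards [hgrad] with u hu
    rw [hu, hN, nsGeneratorPairing_force]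
  have hNint : Integrable N μ := hGint.congr hae
  have hN0 : ∫ u, N u ∂μ = 0 := by rw [← integral_congr_ae hae]; exact hG0
  -- integrability of the pieces
  have hEint : Integrable (fun u : Torus.energySpace (Fin 3) => ‖u‖ ^ 2) μ := hμ.integrable_norm_sq
  have hnormint : Integrable (fun u : Torus.energySpace (Fin 3) => ‖u‖) μ := hμ.integrable_norm
  have hPint : Integrable (fun u : Torus.energySpace (Fin 3) => Torus.pairing (u : Lp (EuclideanSpace ℝ (Fin 3)) 2 (volume : Measure (UnitAddTorus (Fin 3)))) (Torus.laplacian f)) μ := by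
    refine Integrable.mono' (hnormint.mul_const L) (Torus.continuous_pairing_coe hΔ2).aestronglyMeasurable
      (ae_of_all _ fun u => ?_)
    rw [Real.norm_eq_abs]
    exact Torus.abs_pairing_coe_le hΔ2 u
  have hCint : Integrable (fun _ : Torus.energySpace (Fin 3) => ∫ x, ‖f x‖ ^ 2) μ := integrable_const _
  have hIint : Integrable (fun u : Torus.energySpace (Fin 3) => Torus.inertialPairing (u : Lp (EuclideanSpace ℝ (Fin 3)) 2 (volume : Measure (UnitAddTorus (Fin 3)))) f) μ := by
    have h := (hNint.sub hCint).sub (hPint.const_mul ν)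
    refine h.congr (ae_of_all _ fun u => ?_)
    simp only [hN, Pi.sub_apply]
    ring
  -- split the integral of `N`
  have hsplit : ∫ u, N u ∂μ = (∫ x, ‖f x‖ ^ 2) + ν * ∫ u, Torus.pairing (u : Lp (EuclideanSpace ℝ (Fin 3)) 2 (volume : Measure (UnitAddTorus (Fin 3)))) (Torus.laplacian f) ∂μ +
      ∫ u, Torus.inertialPairing (u : Lp (EuclideanSpace ℝ (Fin 3)) 2 (volume : Measure (UnitAddTorus (Fin 3)))) f ∂μ := by
    have hA : Integrable (fun u : Torus.energySpace (Fin 3) => (∫ x, ‖f x‖ ^ 2) + ν * Torus.pairing (u : Lp (EuclideanSpace ℝ (Fin 3)) 2 (volume : Measure (UnitAddTorus (Fin 3)))) (Torus.laplacian f)) μ :=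
      hCint.add (hPint.const_mul ν)
    have hB : Integrable (fun u : Torus.energySpace (Fin 3) => ν * Torus.pairing (u : Lp (EuclideanSpace ℝ (Fin 3)) 2 (volume : Measure (UnitAddTorus (Fin 3)))) (Torus.laplacian f)) μ := hPint.const_mul ν
    simp only [hN]
    rw [integral_add hA hIint, integral_add hCint hB, integral_const_mul]
    simp
  -- Cauchy–Schwarz bounds
  have hP : -(∫ u, Torus.pairing (u : Lp (EuclideanSpace ℝ (Fin 3)) 2 (volume : Measure (UnitAddTorus (Fin 3)))) (Torus.laplacian f) ∂μ) ≤ L * Real.sqrt (Torus.ensembleEnergy μ) := by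
    have h1 : ∫ u, -Torus.pairing (u : Lp (EuclideanSpace ℝ (Fin 3)) 2 (volume : Measure (UnitAddTorus (Fin 3)))) (Torus.laplacian f) ∂μ ≤ ∫ u : Torus.energySpace (Fin 3), L * ‖u‖ ∂μ := by
      refine integral_mono hPint.neg (hnormint.const_mul L) fun u => ?_
      have := Torus.abs_pairing_coe_le hΔ2 u
      rw [mul_comm] at this
      exact (neg_le_abs _).trans this
    rw [integral_neg, integral_const_mul] at h1
    have h2 : ∫ u : Torus.energySpace (Fin 3), ‖u‖ ∂μ ≤ Real.sqrt (Torus.ensembleEnergy μ) :=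
      Torus.integral_le_sqrt_integral_sq (ae_of_all _ fun u => norm_nonneg u) continuous_norm.aestronglyMeasurable hEint
    exact h1.trans (mul_le_mul_of_nonneg_left h2 hL0)
  have hI : -(∫ u, Torus.inertialPairing (u : Lp (EuclideanSpace ℝ (Fin 3)) 2 (volume : Measure (UnitAddTorus (Fin 3)))) f ∂μ) ≤ K * Torus.ensembleEnergy μ := by
    have h1 : ∫ u, -Torus.inertialPairing (u : Lp (EuclideanSpace ℝ (Fin 3)) 2 (volume : Measure (UnitAddTorus (Fin 3)))) f ∂μ ≤ ∫ u : Torus.energySpace (Fin 3), K * ‖u‖ ^ 2 ∂μ := by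
      refine integral_mono hIint.neg (hEint.const_mul K) fun u => ?_
      exact (neg_le_abs _).trans (abs_inertialPairing_le_of_fderiv_le hK u)
    rw [integral_neg, integral_const_mul] at h1
    exact h1
  rw [hsplit] at hN0
  nlinarith [mul_le_mul_of_nonneg_left hP hν.le]

/-- **No lean statistics.** Every stationary statistical solution of `NS_ν(f)` (`ν > 0`, `f` smooth solenoidal
mean-zero with `‖∇f‖ ≤ K`) has `e(μ) ≥ min(1, (‖f‖₂²/(ν‖Δf‖₂ + K))²)` — a ν-uniform (for `ν ≤ 1`) positive lower bound
on the energy of EVERY invariant statistics of a nonzero force. For the crux: the quiet side of the adversary can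
never be realised near rest; for the ceiling: `E ≥ ‖f‖₂²/‖∇f‖_∞ − O(ν)` (cf. `Negative/InertialBound`). -/
theorem ensembleEnergy_lower_bound {ν : ℝ} (hν : 0 < ν) {f : (UnitAddTorus (Fin 3) → EuclideanSpace ℝ (Fin 3))} (hfs : Torus.IsSmooth f)
    (hfd : Torus.IsDivFree f) (hfz : Torus.HasZeroMean f) {K : ℝ} (hK : ∀ x, ‖Torus.fderiv f x‖ ≤ K)
    {μ : Measure (Torus.energySpace (Fin 3))} (hμ : Torus.IsStationaryStatisticalSolution ν f μ) :
    min 1 (((∫ x, ‖f x‖ ^ 2) / (ν * ‖(hfs.laplacian.memLp 2).toLp (Torus.laplacian f)‖ + K)) ^ 2) ≤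
      Torus.ensembleEnergy μ := by
  haveI := hμ.prob
  set e : ℝ := Torus.ensembleEnergy μ with he
  set L : ℝ := ‖(hfs.laplacian.memLp 2).toLp (Torus.laplacian f)‖ with hL
  set F2 : ℝ := ∫ x, ‖f x‖ ^ 2 with hF2
  have he0 : 0 ≤ e := integral_nonneg fun u => by positivity
  have hF20 : 0 ≤ F2 := integral_nonneg fun x => by positivity
  have hL0 : 0 ≤ L := norm_nonneg _
  have hK0 : 0 ≤ K := (norm_nonneg _).trans (hK 0)
  have hmain : F2 ≤ ν * (L * Real.sqrt e) + K * e := force_sq_le_of_isStationary hν hfs hfd hfz hK hμ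
  by_cases h1 : 1 ≤ e
  · exact (min_le_left _ _).trans h1
  · have he1 : e ≤ 1 := (not_le.1 h1).le
    have hsq : e ≤ Real.sqrt e := by
      rw [Real.le_sqrt he0 he0]
      nlinarith
    have h2 : F2 ≤ (ν * L + K) * Real.sqrt e := by nlinarith [mul_le_mul_of_nonneg_left hsq hK0]
    by_cases h0 : ν * L + K = 0
    · have hF : F2 ≤ 0 := by rw [h0, zero_mul] at h2; exact h2
      have : F2 = 0 := le_antisymm hF hF20
      rw [this, zero_div]
      simpa using he0
    · have hpos : 0 < ν * L + K := lt_of_le_of_ne (by positivity) (Ne.symm h0)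
      have h3 : F2 / (ν * L + K) ≤ Real.sqrt e := by rw [div_le_iff₀ hpos, mul_comm]; exact h2
      have h4 : (F2 / (ν * L + K)) ^ 2 ≤ (Real.sqrt e) ^ 2 := pow_le_pow_left₀ (by positivity) h3 2
      rw [Real.sq_sqrt he0] at h4
      exact (min_le_right _ _).trans h4

/-! ## Load-bearing analysis: the ceiling half alone is vacuous (f = 0) -/

/-- **Unforced stationary statistics are trivial.** For `f = 0` and `ν > 0`, every stationary statistical solution
of `NS_ν(0)` has `e(μ) = 0`: the mean energy inequality gives `ν ∫‖∇u‖² dμ ≤ 0`, so `‖∇u‖ = 0` `μ`-a.e., so `u = 0`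
`μ`-a.e. (Poincaré on the mean-zero space). -/
theorem ensembleEnergy_eq_zero_of_zero_force {ν : ℝ} (hν : 0 < ν) {μ : Measure (Torus.energySpace (Fin 3))}
    (hμ : Torus.IsStationaryStatisticalSolution ν (0 : (UnitAddTorus (Fin 3) → EuclideanSpace ℝ (Fin 3))) μ) : Torus.ensembleEnergy μ = 0 := by
  haveI := hμ.prob
  have hf : MemLp (0 : (UnitAddTorus (Fin 3) → EuclideanSpace ℝ (Fin 3))) 2 volume := memLp_const (μ := (volume : Measure (UnitAddTorus (Fin 3)))) 0
  have hE := Torus.IsStationaryStatisticalSolution.energy_le_holds hμ hf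
  have hpair0 : ∀ u : Torus.energySpace (Fin 3), Torus.pairing (u : Lp (EuclideanSpace ℝ (Fin 3)) 2 (volume : Measure (UnitAddTorus (Fin 3)))) (0 : (UnitAddTorus (Fin 3) → EuclideanSpace ℝ (Fin 3))) = 0 := fun u => by
    simp [Torus.pairing]
  simp only [hpair0, integral_zero] at hE
  have hfin : Torus.ensembleEnstrophy μ ≠ ⊤ := hμ.enstrophy_finite.ne
  have htr : (Torus.ensembleEnstrophy μ).toReal = 0 := by
    have h0 : 0 ≤ (Torus.ensembleEnstrophy μ).toReal := ENNReal.toReal_nonneg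
    nlinarith [mul_nonneg hν.le h0]
  have hzero : Torus.ensembleEnstrophy μ = 0 := by
    rcases (ENNReal.toReal_eq_zero_iff _).1 htr with h | h
    · exact h
    · exact absurd h hfin
  have hae : ∀ᵐ u : Torus.energySpace (Fin 3) ∂μ, Torus.eGradNormSq ((u : Lp (EuclideanSpace ℝ (Fin 3)) 2 (volume : Measure (UnitAddTorus (Fin 3)))) : UnitAddTorus (Fin 3) → EuclideanSpace ℝ (Fin 3)) = 0 := by
    have h' : ∫⁻ u : Torus.energySpace (Fin 3), Torus.eGradNormSq ((u : Lp (EuclideanSpace ℝ (Fin 3)) 2 (volume : Measure (UnitAddTorus (Fin 3)))) : UnitAddTorus (Fin 3) → EuclideanSpace ℝ (Fin 3)) ∂μ = 0 := hzero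
    have h'' := (lintegral_eq_zero_iff (Torus.measurable_eGradNormSq_coe (d := Fin 3))).1 h'
    filter_upwards [h''] with u hu
    simpa using hu
  have hnorm : ∀ᵐ u : Torus.energySpace (Fin 3) ∂μ, ‖u‖ ^ 2 = (0 : ℝ) := by
    filter_upwards [hae] with u hu
    have hP := Torus.norm_sq_le_toReal_eGradNormSq u (by rw [hu]; exact ENNReal.zero_ne_top)
    rw [hu, ENNReal.toReal_zero] at hP
    have hpi : 0 < 4 * Real.pi ^ 2 := by positivity
    have : ‖u‖ ^ 2 ≤ 0 := by
      by_contra hc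
      have hc' : 0 < ‖u‖ ^ 2 := lt_of_not_ge hc
      linarith [mul_pos hpi hc']
    exact le_antisymm this (sq_nonneg _)
  unfold Torus.ensembleEnergy
  rw [integral_congr_ae hnorm, integral_zero]

/-- **LOAD-BEARING: the FLOOR conjunct.** Without the FLOOR the crux is TRUE for the wrong reason: the trivial force
(admissible — `X` does not say `f ≠ 0`) carries the ν-uniform ensemble ceiling with `E = 0`, since every stationary
statistics of unforced Navier–Stokes has zero energy. (`X` itself excludes `f = 0` only through the floor:
`Negative/SteadyPinch.force_pos_of_pair`.) -/
theorem floorCertificateEnsembleCeiling_without_floor_trivial :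
    ∃ f : (UnitAddTorus (Fin 3) → EuclideanSpace ℝ (Fin 3)), Torus.IsSmooth f ∧ Torus.IsDivFree f ∧ Torus.HasZeroMean f ∧
      ∃ (E ν₀ : ℝ), 0 < ν₀ ∧ ∀ ν : ℝ, 0 < ν → ν < ν₀ →
      (∀ μ : Measure (Torus.energySpace (Fin 3)), Torus.IsStationaryStatisticalSolution ν f μ →
        Integrable (fun v : Torus.energySpace (Fin 3) => ‖v‖ ^ 2) μ → Torus.ensembleEnergy μ ≤ E) := by
  have hdiv : Torus.IsDivFree (0 : (UnitAddTorus (Fin 3) → EuclideanSpace ℝ (Fin 3))) := by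
    have h : Torus.IsDivFree (Torus.realTrigPoly (∅ : Finset (Fin 3 → ℤ)) (0 : (Fin 3 → ℤ) → EuclideanSpace ℂ (Fin 3))) :=
      Torus.isDivFree_realTrigPoly (fun k hk => by simp at hk)
    rwa [Torus.realTrigPoly_zero] at h
  refine ⟨0, Torus.isSmooth_const (0 : EuclideanSpace ℝ (Fin 3)), hdiv, ?_, 0, 1, one_pos, fun ν hν _ μ hμ _ => ?_⟩
  · simp [Torus.HasZeroMean]
  · exact (ensembleEnergy_eq_zero_of_zero_force hν hμ).le

end Summit.AnomalousDissipation.AnomalousDissipation.Theorems.FloorCertificateEnsembleCeiling.Negative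

end
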